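/-
COR-CM (cell pub-hodgecm2, stage 2 of the Hodge ladder) — **S-f** (the COORDINATOR's name, rulings 14:05Z (2) HOME∕INBOX l.18401: «successor END S-f = S-e′ with T consumed»;
PLANNER-A T ROW TABLE r1 l.18409; referee mukey-ref-2: Q1 = YES l.18265, «T = ✔ Ω-VII :311∕:369» l.18439; seat prover-pub-hodgecm2-mukey-p8-g3-0 = mukey-p8) = ✔ S-e′ p380384
`D2Bridge/ClosedPrintedMuKeyIdentLemD3DelRecConjOmega.lean` (tree sha16 307038faebe3cd45) with its `hΩ` sub-binder DROPPED and the [Liu2021, Thm. 4.18] conclusion of the `hLiu418` row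
RE-DISPLAYED as VERBATIM the `h′` hypothesis type of T = ✔ Ω-VII p380419 `D2Bridge/MuConjIdentificationOmega.lean` :311
`Summit.HodgeConjecture.CorCM.D2Bridge.MuConjIdent.thm418AsPrinted_muConj_rest_of_transport_hermConj` at the END's objects — [Thm. 4.18] AS PRINTED for the CONJUGATE space
`(𝕍^(c), ν)` at its transported datum (group `U(V^(c))(𝔸_{F⁺,f})` natively, Liu's own collections map `epsOf δ′`, the conjugate space's own [Def. 4.11] family at the
label `ν`; `Φ′` universally quantified; tail `t` := the tail of record at `ν`, so the source datum is S-e′'s printed datum `D_print(a, ν)` by `rfl`) — and the proof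
TRANSPORTS IT BACK IN KERNEL by ONE application of T (its `hδ′c ∕ hδ′0` inputs discharged by ✔ `OmegaTransport` lemmas), then S-e′'s term verbatim.  Generator
`HOME/d2bridge/mukey/SUCC-END/mukey-p8/gen_sf.py` from the tree S-e′ bytes; no helper re-declared (✔ S-e′'s `diagonal_frameD_map_complexConj` is imported and opened).
LINEAGE (S-e′ header, kept): S-e′ = the FINAL-FORM successor END on the LemD3⊕DelRec base — the seven rows of ✔ N211 `Summit.HodgeConjecture.CorCM.D2Bridge.MuKeyIdentLemD3EndDelRec.hc_cm_of_printed_citations_muKey_ident_lemD3_delRec`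
(`Summits/HodgeConjecture/CorCM/D2Bridge/ClosedPrintedMuKeyIdentLemD3DelRec.lean`, p379848, sha16 9727b1b836b6c458: {hDel, h21, hLiu418, h411, h413, hD3, hD1''} — no legs, no residual)
with the `hLiu418` row carrying BOTH identification binders exactly as in the S-e edition `D2Bridge/ClosedPrintedMuKeyIdentDelRecConjOmega.lean` (pen mukey-p8, c3f7bdf0426b7b58):
the SPACE identification `(R', hR')` = VERBATIM the conclusion of ✔ R10 `Summit.HodgeConjecture.CorCM.D2Bridge.MuConjIdent.exists_recordSystemConj_X_sec42DataOf_levelOf_eq`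
(module `HComp.RecordSystemConj`) and the ω-SIDE identification `hΩ` = VERBATIM the conclusion of Ω (M)
`Summit.HodgeConjecture.CorCM.HComp.OmegaConj.exists_uniformOmegaRep_conj_hermConj` (module `HComp.RecordSystemConjOmegaTwistModel`), BOTH DISCHARGED IN KERNEL inside the proof.
Rows hDel ∕ h21 ∕ h411 ∕ h413 ∕ hD3 ∕ hD1'' are N211's bytes verbatim; hLiu418 is S-e's row verbatim; the proof is ONE application of ✔ N157
`Summit.HodgeConjecture.CorCM.D2Bridge.MuKeyIdentLemD3End.hc_cm_of_printed_citations_muKey_ident_lemD3` at `h := DelRec.exists_recordSystem_of_printed hDel` with the two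
identification binders discharged by the theorems just named (S-e′ was generated by `gen_se_prime.py` from the tree N211 bytes and the S-e v3 bytes).
THIS FILE (S-f): THEOREMS ONLY (kernel lane): no `def`, no instance, no `variable`, no notation, no `sorry`; nothing landed is edited or restated; new declaration
name in a new namespace; seat prover-pub-hodgecm2-mukey-p8-g3-0, 2026-08-24.
FRAMING: HC_CM is NOT proved unconditionally (the displayed citations are hypotheses); this file claims no pointer ∕ label ∕ count move; HELD — WORLD = C FINAL.
-/
import Summits.HodgeConjecture.CorCM.D2Bridge.ClosedPrintedMuKeyIdentLemD3
import Summits.HodgeConjecture.CorCM.DelRec.RecordSystemOfPrinted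
import Summits.HodgeConjecture.CorCM.B01.Transposition.HComp.RecordSystemConj
import Summits.HodgeConjecture.CorCM.B01.Transposition.HComp.RecordSystemConjOmegaTwistModel
import Summits.HodgeConjecture.CorCM.D2Bridge.MuConjIdentificationOmega
import Summits.HodgeConjecture.CorCM.D2Bridge.ClosedPrintedMuKeyIdentLemD3DelRecConjOmega
import HarnessLib

/-!
# S-f: the LemD3⊕DelRec END with [Liu21, Thm 4.18] displayed AT THE CONJUGATE SPACE's TRANSPORTED DATUM (the `h′` of T = ✔ Ω-VII :311) under the space-identification binder; T consumed in kernel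

* `hc_cm_of_printed_citations_muKey_ident_lemD3_delRecConjOmegaT` — the END.  DISPLAYED (7 Prop binders, 0 data binders): `hDel` ([Del79] 2.2.5 + Cor. 2.7.21 as printed),
  `h21` ([Shi98] 21.4 + [Cas]), `hLiu418` ([Liu21] Thm 4.18 AS PRINTED for the conjugate space `(𝕍^(c), ν)` at the transported datum
  `(toThm418Data ℭ_V ((muConj 𝕌_V).rest t)).transport 𝔾_{V^(c)} (adelicFinConj V)⁻¹ Eps (epsOf δ′) Chi (𝕌_{V^(c)}.omega ν hν) (𝕌_{V^(c)}.rho ν hν)` — VERBATIM the `h′` type of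
  ✔ Ω-VII :311 at the END's objects, `t` the tail of record (source datum = S-e′'s `D_print(a, ν)` by `rfl`), `Φ′` ∀-bound — under the space binder `(R', hR')`; NO `hΩ`),
  `h411` ([Liu21] Def 4.11 ∕ Prop 4.13 carriers), `h413` ([Liu21] Prop 4.13), `hD3` ([Liu21] Lem D.1 (3) as printed, indexed family), `hD1''` ([Liu21] Lem D.1 (1) as printed) —
  rows 1, 2, 4–7 BYTE-IDENTICAL to ✔ S-e′.  KERNEL: `obtain ⟨R', hR'⟩ := R6 …`, then T (:311) applied to `hLiu418 … R' hR' Φ` lands in the `hLiu418` slot of ✔ N157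
  `MuKeyIdentLemD3End.hc_cm_of_printed_citations_muKey_ident_lemD3` — it elaborates because `(muConj 𝕌).rest t` and `D_print(a, ν)` are definitionally one (G62 §6 ∕ T-4).
  HC_CM is NOT proved unconditionally; nothing displayed is inhabited here; the space binder is ∀-bound INSIDE the row and supplied by a kernel theorem; the print-level
  residue (L) named by mukey-ref-2 (Hecke compatibility of the conjugate record, [Del79] 2.7.21 ∕ [Mil05] 13.6) is cite-side and NOT asserted here; every (R2) ∕ print-instance
  word on these bytes is the referees'.
[Liu2021] Thm 4.18, Def 4.11–4.12, Prop 4.13, Lem D.1; [Deligne1979ShimuraVarieties] 2.1.2–2.1.4, 2.2.4–2.2.5, Cor. 2.7.21; [Milne2005ShimuraVarieties] Def. 12.8, 12.10; [Kudla1996] V.3.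
-/

set_option autoImplicit false

noncomputable section

namespace Summit.HodgeConjecture.CorCM.D2Bridge.MuKeyIdentLemD3DelRecConjOmegaEndT

open scoped TensorProduct Matrix
open NumberField NumberField.InfinitePlace
open HodgeCM.Model HodgeCM.Model.LiuIndex HodgeCM.Model.TowerCarrier
open HodgeCM.Literature.Theta.LiuAlbaneseModuleDatum.D2Bridge (HcmPieces)
open Summit.HodgeConjecture.CorCM.Model
open Literature.AlgebraicGeometry.Motives (CMType)
open Literature.AlgebraicGeometry.HodgeTheory Literature.NumberTheory.Automorphic.PicardCM
open Literature.AlgebraicGeometry.ShimuraVarieties.UnitaryCanonicalModel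
open Literature.NumberTheory.ComplexMultiplication
open Literature.NumberTheory.Automorphic
open Literature.NumberTheory.Automorphic.IdeleClassGroup (toHeckeCharacter isUnitary_toHeckeCharacter galConj)
open Literature.NumberTheory.Automorphic.Liu2021 Literature.NumberTheory.Automorphic.Liu2021.AppendixC
open Literature.NumberTheory.Automorphic.Liu2021.AppendixC.RestOne
open Literature.NumberTheory.Automorphic.Liu2021.Def411WeilCarriers (lineOf locF Rep)
open Summit.HodgeConjecture.CorCM.Transposition.OmegaTransport (realUnit)
open HodgeCM.Model.ArchSideTerm (e₁)
open Literature.NumberTheory.GelbartRogawski1991 Literature.NumberTheory.GelbartRogawski1991.UnitaryDualPair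
open Literature.NumberTheory.GelbartRogawski1991.UnitaryDualPair.LocalSplitting (localMu norm_localMu continuous_localMu localMu_toLocalRing_eq_one_iff
  eq_of_forall_localMu_toHeckeCharacter_eq)
open Literature.RepresentationTheory Literature.RepresentationTheory.Liu2021
open Summit.HodgeConjecture.CorCM.Transposition
open Summit.HodgeConjecture.CorCM.D2Bridge.AdapterMuConj (muConj prop413AsPrinted_muConj def411_muConj nontrivial_omegaAt_muConj_rest)
open Summit.HodgeConjecture.CorCM.D2Bridge.MuKeyIdentEnd (hc_cm_of_printed_citations_muKey_ident)
open Summit.HodgeConjecture.CorCM.D2Bridge.MuKeyIdentLemD3End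
open Summit.HodgeConjecture.CorCM.D2Bridge.MuKeyIdentLemD3DelRecConjOmegaEnd (diagonal_frameD_map_complexConj)

/-! ## S-f: the END on the LemD3⊕DelRec base with the space-identification binder, [Thm. 4.18] displayed at the CONJUGATE SPACE's TRANSPORTED datum (the h′ type of ✔ Ω-VII :311 = T), transported back in kernel by T -/

set_option synthInstance.maxHeartbeats 400000 in
set_option maxHeartbeats 8000000 in
/-- **S-f — the LemD3⊕DelRec successor END with [Liu 2021, Thm 4.18] displayed at the CONJUGATE SPACE's TRANSPORTED datum, T = ✔ Ω-VII :311 consumed in kernel.**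
The `hLiu418` row reads, after S-e′'s face prefix and space binder `(R', hR')` and a ∀-bound type token `Φ'` of the conjugate space: `Thm418AsPrinted ((toThm418Data ℭ_V
((muConj 𝕌_V).rest t)).transport (sec42DataOf h isoOf F ι₁ V.conj Φ').G (HermSpace3.adelicFinConj V).symm Eps (epsOf δ′) Chi (𝕌_{V^(c)}.omega ν hν) (𝕌_{V^(c)}.rho ν hν))`
— VERBATIM the `h′` type of ✔ `MuConjIdent.thm418AsPrinted_muConj_rest_of_transport_hermConj` (:311) at the END's objects (`𝕌_{V^(c)} := uniformOmegaRep h F ι₁ V.conj Φ' e₁ dV …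
(iotaVConj …) δ′ (repConj F r)` the conjugate space's OWN [Def. 4.11 ∕ 4.12] family at the label `ν`, group `U(V^(c))(𝔸_{F⁺,f})` acting natively, Liu's OWN `epsOf δ′`;
`t := restTailOne (AlgHom.id ℚ F) ι₁ hν hw 𝒞(ν) (𝕋.rhoΩOne …)` the tail of record at `ν`, so the source datum is `D_print(a, ν)` of ✔ S-e′ by `rfl`); S-e′'s `hΩ` sub-binder is
NOT displayed (T consumes ✔ Ω-M internally).  KERNEL: ONE application of T transports the row BACK to `D_print(a, ν)` (`Φ' := Φ`; `c(δ′) = −δ′`, `δ′ ≠ 0` by ✔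
`OmegaTransport` lemmas), then S-e′'s term.  LINEAGE (S-e′ docstring, kept for the six unchanged rows): Displayed rows = ✔ N211 `MuKeyIdentLemD3EndDelRec.hc_cm_of_printed_citations_muKey_ident_lemD3_delRec` verbatim (hDel ∕ h21 ∕ h411 ∕ h413 ∕ hD3 ∕ hD1''), except that the
`hLiu418` row ([Liu21, Thm 4.18] AS PRINTED at the printed datum `D_print(a, ν)`) is read UNDER TWO ∀-BOUND IDENTIFICATION BINDERS, both stated as the VERBATIM conclusions of
tree theorems and DISCHARGED IN KERNEL in the proof: `(R', hR')` — the datum's tower of models IS the model functor of a Deligne record `R'` of the CONJUGATE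
hermitian space `c(V)` along `ι₁` (✔ R10 `MuConjIdent.exists_recordSystemConj_X_sec42DataOf_levelOf_eq`); `hΩ` — for every CM type `Φ'`, every section `r'` with
`r'_ν(ε′) = −r_{νᶜ}(ε)` and every `χ′ = χ⁻¹`, the datum's block `𝕌_V.omega νᶜ (ε, χ)` is ℂ-linearly isomorphic, equivariantly along `g ↦ ḡ` (`HComp.OmegaConj.phiConj`), to the
conjugate space's own [Def 4.11] carrier `𝕌_{c(V)}.omega ν (ε′, χ′)` (Ω (M) `HComp.OmegaConj.exists_uniformOmegaRep_conj_hermConj`).  KERNEL: ONE application of ✔ N157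
`MuKeyIdentLemD3End.hc_cm_of_printed_citations_muKey_ident_lemD3` at `h := DelRec.exists_recordSystem_of_printed hDel`, its `hLiu418` supplied, in THIS file, from the displayed row by
`obtain ⟨R', hR'⟩ := …exists_recordSystemConj_X_sec42DataOf_levelOf_eq …` and `exact MuConjIdent.thm418AsPrinted_muConj_rest_of_transport_hermConj … ν hν _ (hLiu418 … R' hR' Φ)`.
HC_CM is NOT proved unconditionally: the displayed citations are hypotheses; whether this is a record is the COORDINATOR's ∕ referees' call.
[cite: Liu2021, Thm 4.18 p. 52; Def 4.11–4.12 pp. 48–49; Prop 4.13 p. 50; App. D Lem D.1 pp. 86–87; App. C §C.1 and Rem. C.2]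
[cite: Deligne1979ShimuraVarieties, §2.1.2–2.1.4, 2.2.4–2.2.5 and Cor. 2.7.21 (PDF pp. 24, 29, 52 of Milne's translation)]
[cite: Milne2005ShimuraVarieties, Def. 12.8 (62) p. 114; Def. 12.10 p. 115] [cite: Kudla1996, V.3] -/
theorem hc_cm_of_printed_citations_muKey_ident_lemD3_delRecConjOmegaT
    (hDel : Literature.AlgebraicGeometry.ShimuraVarieties.UnitaryCanonicalModel.canonicalModel_exists_printed)
    (h21 : shimura1998_thm21_4_casselman)
    -- [Liu21, Thm 4.18] AS PRINTED for the CONJUGATE space (𝕍^(c), ν): the TRANSPORTED datum = VERBATIM the h′ type of T = ✔ Ω-VII :311 `MuConjIdent.thm418AsPrinted_muConj_rest_of_transport_hermConj` at the END's objects (group U(V^(c))(𝔸_{F⁺,f}) natively through (adelicFinConj V)⁻¹, Liu's own collections map `epsOf δ′`, the conjugate space's own [Def 4.11] family 𝕌_{V^(c)} at the label ν; tail t = the rest of record at ν, so the source datum is D_print(a, ν) by rfl), UNDER the space-identification binder (R', hR') = the conclusion of R6 VERBATIM; Φ′ universally quantified; NO hΩ binder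
    (hLiu418 : ∀ (F : HodgeCM.CMField) [IsGalois ℚ F] (h6 : 6 ≤ Module.finrank ℚ F) {ι₁ : F →+* ℂ} (V : HodgeCM.HermSpace3 F ι₁) (a : RealScalar F)
      (Φ : CMType F) (hΦ : ι₁ ∈ Φ.1) (ν : Literature.NumberTheory.Automorphic.IdeleClassGroup (F : Type) →ₜ* Circle)
      (hν : IdeleClassGroup.IsConjugateSymplectic (F : Type) ν) (hw : IdeleClassGroup.HasWeight (F : Type) ν 1)
      (R' : RecordSystem (HodgeCM.CMField.K F) (Summit.HodgeConjecture.CorCM.Model.RecordSystemConj.conjGram (HodgeCM.CMField.K F) (HodgeCM.HermSpace3.Hm V)) ι₁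
        (Summit.HodgeConjecture.CorCM.Model.RecordSystemConj.conjFrame (Summit.HodgeConjecture.CorCM.Model.frameOf (⟨HodgeCM.HermSpace3.Hm V, HodgeCM.HermSpace3.isHermitian V, HodgeCM.HermSpace3.signature_ι₁ V, HodgeCM.HermSpace3.posDef_of_ne V⟩ : Summit.HodgeConjecture.CorCM.HermSpace3 ⟨HodgeCM.CMField.K F⟩ ι₁)))
        (Summit.HodgeConjecture.CorCM.Model.RecordSystemConj.formCongr_conjFrame (HodgeCM.CMField.K F) (HodgeCM.HermSpace3.Hm V) ι₁ (Summit.HodgeConjecture.CorCM.Model.frameOf (⟨HodgeCM.HermSpace3.Hm V, HodgeCM.HermSpace3.isHermitian V, HodgeCM.HermSpace3.signature_ι₁ V, HodgeCM.HermSpace3.posDef_of_ne V⟩ : Summit.HodgeConjecture.CorCM.HermSpace3 ⟨HodgeCM.CMField.K F⟩ ι₁))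
          (Summit.HodgeConjecture.CorCM.Model.formCongr_frameOf (⟨HodgeCM.HermSpace3.Hm V, HodgeCM.HermSpace3.isHermitian V, HodgeCM.HermSpace3.signature_ι₁ V, HodgeCM.HermSpace3.posDef_of_ne V⟩ : Summit.HodgeConjecture.CorCM.HermSpace3 ⟨HodgeCM.CMField.K F⟩ ι₁)))
        (Summit.HodgeConjecture.CorCM.Model.RecordSystemConj.conjLevel₀ (HodgeCM.CMField.K F) (HodgeCM.HermSpace3.Hm V) (Summit.HodgeConjecture.CorCM.HComp.K3 (⟨HodgeCM.HermSpace3.Hm V, HodgeCM.HermSpace3.isHermitian V, HodgeCM.HermSpace3.signature_ι₁ V, HodgeCM.HermSpace3.posDef_of_ne V⟩ : Summit.HodgeConjecture.CorCM.HermSpace3 ⟨HodgeCM.CMField.K F⟩ ι₁))))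
      (hR' : CategoryTheory.Functor.comp (Summit.HodgeConjecture.CorCM.Model.RecordSystemConj.smallLevelConjBack (HodgeCM.CMField.K F) (HodgeCM.HermSpace3.Hm V) (Summit.HodgeConjecture.CorCM.HComp.K3 (⟨HodgeCM.HermSpace3.Hm V, HodgeCM.HermSpace3.isHermitian V, HodgeCM.HermSpace3.signature_ι₁ V, HodgeCM.HermSpace3.posDef_of_ne V⟩ : Summit.HodgeConjecture.CorCM.HermSpace3 ⟨HodgeCM.CMField.K F⟩ ι₁))) (Summit.HodgeConjecture.CorCM.Model.sec42DataOfFourLe (Summit.HodgeConjecture.CorCM.DelRec.exists_recordSystem_of_printed hDel) (⟨HodgeCM.HermSpace3.Hm V, HodgeCM.HermSpace3.isHermitian V, HodgeCM.HermSpace3.signature_ι₁ V, HodgeCM.HermSpace3.posDef_of_ne V⟩ : Summit.HodgeConjecture.CorCM.HermSpace3 ⟨HodgeCM.CMField.K F⟩ ι₁) Φ (le_trans (Nat.le_of_ble_eq_true rfl) h6) (isoOf ⟨HodgeCM.CMField.K F⟩ ι₁ (⟨HodgeCM.HermSpace3.Hm V, HodgeCM.HermSpace3.isHermitian V, HodgeCM.HermSpace3.signature_ι₁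 V, HodgeCM.HermSpace3.posDef_of_ne V⟩ : Summit.HodgeConjecture.CorCM.HermSpace3 ⟨HodgeCM.CMField.K F⟩ ι₁) Φ)).cpt.X = R'.M ∧
        ∀ K : Subgroup (Summit.HodgeConjecture.CorCM.Model.honestP5Of (Summit.HodgeConjecture.CorCM.DelRec.exists_recordSystem_of_printed hDel) ⟨HodgeCM.CMField.K F⟩ ι₁ ⟨HodgeCM.HermSpace3.Hm V, HodgeCM.HermSpace3.isHermitian V, HodgeCM.HermSpace3.signature_ι₁ V, HodgeCM.HermSpace3.posDef_of_ne V⟩ Φ).G,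
          (sec42DataOf (Summit.HodgeConjecture.CorCM.DelRec.exists_recordSystem_of_printed hDel) isoOf ⟨HodgeCM.CMField.K F⟩ ι₁ ⟨HodgeCM.HermSpace3.Hm V, HodgeCM.HermSpace3.isHermitian V, HodgeCM.HermSpace3.signature_ι₁ V, HodgeCM.HermSpace3.posDef_of_ne V⟩ Φ).X ((sec42DataOf (Summit.HodgeConjecture.CorCM.DelRec.exists_recordSystem_of_printed hDel) isoOf ⟨HodgeCM.CMField.K F⟩ ι₁ ⟨HodgeCM.HermSpace3.Hm V, HodgeCM.HermSpace3.isHermitian V, HodgeCM.HermSpace3.signature_ι₁ V, HodgeCM.HermSpace3.posDef_of_ne V⟩ Φ).levelOf K) =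
            R'.M.obj (⟨C5.OpenCompactSubgroup.transport (Summit.HodgeConjecture.CorCM.Model.RecordSystemConj.groupConj (HodgeCM.CMField.K F) (HodgeCM.HermSpace3.Hm V)) ((Summit.HodgeConjecture.CorCM.Model.sec42DataOfFourLe (Summit.HodgeConjecture.CorCM.DelRec.exists_recordSystem_of_printed hDel) (⟨HodgeCM.HermSpace3.Hm V, HodgeCM.HermSpace3.isHermitian V, HodgeCM.HermSpace3.signature_ι₁ V, HodgeCM.HermSpace3.posDef_of_ne V⟩ : Summit.HodgeConjecture.CorCM.HermSpace3 ⟨HodgeCM.CMField.K F⟩ ι₁) Φ (le_trans (Nat.le_of_ble_eq_true rfl) h6) (isoOf ⟨HodgeCM.CMField.K F⟩ ι₁ (⟨HodgeCM.HermSpace3.Hm V, HodgeCM.HermSpace3.isHermitian V, HodgeCM.HermSpace3.signature_ι₁ V, HodgeCM.HermSpace3.posDef_of_ne V⟩ : Summit.HodgeConjecture.CorCM.HermSpace3 ⟨HodgeCM.CMField.K F⟩ ι₁) Φ)).levelOf K).1,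
              C5.OpenCompactSubgroup.transport_mono (Summit.HodgeConjecture.CorCM.Model.RecordSystemConj.groupConj (HodgeCM.CMField.K F) (HodgeCM.HermSpace3.Hm V)) ((Summit.HodgeConjecture.CorCM.Model.sec42DataOfFourLe (Summit.HodgeConjecture.CorCM.DelRec.exists_recordSystem_of_printed hDel) (⟨HodgeCM.HermSpace3.Hm V, HodgeCM.HermSpace3.isHermitian V, HodgeCM.HermSpace3.signature_ι₁ V, HodgeCM.HermSpace3.posDef_of_ne V⟩ : Summit.HodgeConjecture.CorCM.HermSpace3 ⟨HodgeCM.CMField.K F⟩ ι₁) Φ (le_trans (Nat.le_of_ble_eq_true rfl) h6) (isoOf ⟨HodgeCM.CMField.K F⟩ ι₁ (⟨HodgeCM.HermSpace3.Hm V, HodgeCM.HermSpace3.isHermitian V, HodgeCM.HermSpace3.signature_ι₁ V, HodgeCM.HermSpace3.posDef_of_ne V⟩ : Summit.HodgeConjecture.CorCM.HermSpace3 ⟨HodgeCM.CMField.K F⟩ ι₁) Φ)).levelOf K).2⟩ :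
              C5.SmallLevel (Summit.HodgeConjecture.CorCM.Model.RecordSystemConj.conjLevel₀ (HodgeCM.CMField.K F) (HodgeCM.HermSpace3.Hm V) (Summit.HodgeConjecture.CorCM.HComp.K3 (⟨HodgeCM.HermSpace3.Hm V, HodgeCM.HermSpace3.isHermitian V, HodgeCM.HermSpace3.signature_ι₁ V, HodgeCM.HermSpace3.posDef_of_ne V⟩ : Summit.HodgeConjecture.CorCM.HermSpace3 ⟨HodgeCM.CMField.K F⟩ ι₁)))))
      (Φ' : CMType F),
      Thm418AsPrinted ((toThm418Data (sec42DataOf (Summit.HodgeConjecture.CorCM.DelRec.exists_recordSystem_of_printed hDel) isoOf ⟨HodgeCM.CMField.K F⟩ ι₁ ⟨HodgeCM.HermSpace3.Hm V, HodgeCM.HermSpace3.isHermitian V, HodgeCM.HermSpace3.signature_ι₁ V, HodgeCM.HermSpace3.posDef_of_ne V⟩ Φ) ((Summit.HodgeConjecture.CorCM.D2Bridge.AdapterMuConj.muConj (uniformOmegaRep (Summit.HodgeConjecture.CorCM.DelRec.exists_recordSystem_of_printed hDel) ⟨HodgeCM.CMField.K F⟩ ι₁ ⟨HodgeCM.HermSpace3.Hm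 V, HodgeCM.HermSpace3.isHermitian V, HodgeCM.HermSpace3.signature_ι₁ V, HodgeCM.HermSpace3.posDef_of_ne V⟩ Φ e₁ (frameD V) (frameD_real V) (frameD_ne V) (ιVE V) (2 * imagUnit (HodgeCM.CMField.K F))⁻¹ (fun _ _ => (Rep.update ↥(maximalRealSubfield (HodgeCM.CMField.K F)) (imagUnitSq (HodgeCM.CMField.K F)) (Rep.ofLineOf ↥(maximalRealSubfield (HodgeCM.CMField.K F)) (imagUnitSq (HodgeCM.CMField.K F))) (locF ↥(maximalRealSubfield (HodgeCM.CMField.K F)) (imagUnitSq (HodgeCM.CMField.K F)) (realUnit ⟨HodgeCM.CMField.K F⟩ a.1 a.2.1 a.2.2)) (realUnit ⟨HodgeCM.CMField.K F⟩ a.1 a.2.1 a.2.2) rfl)))).rest (restTailOne (AlgHom.id ℚ _) ι₁ hν hw (Def45.Carriers.ofPolDR ν (Def45.PolDR ι₁ hν (Def45.RMuForm ι₁ hν))) ((heckeTranslatesFamilyOf heckeTranslate_definedOver_holds (Summit.HodgeConjecture.CorCM.DelRec.exists_recordSystem_of_printed hDel) isoOf ⟨HodgeCM.CMField.K F⟩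 ι₁ ⟨HodgeCM.HermSpace3.Hm V, HodgeCM.HermSpace3.isHermitian V, HodgeCM.HermSpace3.signature_ι₁ V, HodgeCM.HermSpace3.posDef_of_ne V⟩ Φ h6).rhoΩOne (AlgHom.id ℚ _) ι₁ hν hw (Def45.Carriers.ofPolDR ν (Def45.PolDR ι₁ hν (Def45.RMuForm ι₁ hν))))))).transport
        (sec42DataOf (Summit.HodgeConjecture.CorCM.DelRec.exists_recordSystem_of_printed hDel) isoOf ⟨HodgeCM.CMField.K F⟩ ι₁ (⟨HodgeCM.HermSpace3.Hm V, HodgeCM.HermSpace3.isHermitian V, HodgeCM.HermSpace3.signature_ι₁ V, HodgeCM.HermSpace3.posDef_of_ne V⟩ : Summit.HodgeConjecture.CorCM.HermSpace3 ⟨HodgeCM.CMField.K F⟩ ι₁).conj Φ').G (Summit.HodgeConjecture.CorCM.HermSpace3.adelicFinConj (⟨HodgeCM.HermSpace3.Hm V, HodgeCM.HermSpace3.isHermitian V, HodgeCM.HermSpace3.signature_ι₁ V, HodgeCM.HermSpace3.posDef_of_ne V⟩ : Summit.HodgeConjecture.CorCM.HermSpace3 ⟨HodgeCM.CMField.K F⟩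 ι₁)).symm
        (Literature.NumberTheory.Automorphic.Liu2021.Def411WeilCarriers.Eps ↥(maximalRealSubfield (HodgeCM.CMField.K F)) (imagUnitSq (HodgeCM.CMField.K F))) (Literature.NumberTheory.Automorphic.Liu2021.Def411WeilCarriers.epsOf ↥(maximalRealSubfield (HodgeCM.CMField.K F)) (imagUnitSq (HodgeCM.CMField.K F)) (HodgeCM.CMField.K F) (2 * imagUnit (HodgeCM.CMField.K F))⁻¹)
        (Literature.NumberTheory.Automorphic.Liu2021.Def411WeilCarriers.Chi ↥(maximalRealSubfield (HodgeCM.CMField.K F)) (HodgeCM.CMField.K F) (IsCMField.complexConj (HodgeCM.CMField.K F)))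
        ((uniformOmegaRep (Summit.HodgeConjecture.CorCM.DelRec.exists_recordSystem_of_printed hDel) ⟨HodgeCM.CMField.K F⟩ ι₁ (⟨HodgeCM.HermSpace3.Hm V, HodgeCM.HermSpace3.isHermitian V, HodgeCM.HermSpace3.signature_ι₁ V, HodgeCM.HermSpace3.posDef_of_ne V⟩ : Summit.HodgeConjecture.CorCM.HermSpace3 ⟨HodgeCM.CMField.K F⟩ ι₁).conj Φ' e₁ (frameD V) (frameD_real V) (frameD_ne V) (Summit.HodgeConjecture.CorCM.HComp.OmegaConj.iotaVConj (Summit.HodgeConjecture.CorCM.DelRec.exists_recordSystem_of_printed hDel) ⟨HodgeCM.CMField.K F⟩ ι₁ (⟨HodgeCM.HermSpace3.Hm V, HodgeCM.HermSpace3.isHermitian V, HodgeCM.HermSpace3.signature_ι₁ V, HodgeCM.HermSpace3.posDef_of_ne V⟩ : Summit.HodgeConjecture.CorCM.HermSpace3 ⟨HodgeCM.CMField.K F⟩ ι₁) Φ Φ' (frameD V) (ιVE V) (diagonal_frameD_map_complexConj F V)) (2 * imagUnit (HodgeCM.CMField.K F))⁻¹ (Summit.HodgeConjecture.CorCM.D2Bridge.MuConjIdent.repConj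 ⟨HodgeCM.CMField.K F⟩ (fun _ _ => (Rep.update ↥(maximalRealSubfield (HodgeCM.CMField.K F)) (imagUnitSq (HodgeCM.CMField.K F)) (Rep.ofLineOf ↥(maximalRealSubfield (HodgeCM.CMField.K F)) (imagUnitSq (HodgeCM.CMField.K F))) (locF ↥(maximalRealSubfield (HodgeCM.CMField.K F)) (imagUnitSq (HodgeCM.CMField.K F)) (realUnit ⟨HodgeCM.CMField.K F⟩ a.1 a.2.1 a.2.2)) (realUnit ⟨HodgeCM.CMField.K F⟩ a.1 a.2.1 a.2.2) rfl)))).omega ν hν)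
        ((uniformOmegaRep (Summit.HodgeConjecture.CorCM.DelRec.exists_recordSystem_of_printed hDel) ⟨HodgeCM.CMField.K F⟩ ι₁ (⟨HodgeCM.HermSpace3.Hm V, HodgeCM.HermSpace3.isHermitian V, HodgeCM.HermSpace3.signature_ι₁ V, HodgeCM.HermSpace3.posDef_of_ne V⟩ : Summit.HodgeConjecture.CorCM.HermSpace3 ⟨HodgeCM.CMField.K F⟩ ι₁).conj Φ' e₁ (frameD V) (frameD_real V) (frameD_ne V) (Summit.HodgeConjecture.CorCM.HComp.OmegaConj.iotaVConj (Summit.HodgeConjecture.CorCM.DelRec.exists_recordSystem_of_printed hDel) ⟨HodgeCM.CMField.K F⟩ ι₁ (⟨HodgeCM.HermSpace3.Hm V, HodgeCM.HermSpace3.isHermitian V, HodgeCM.HermSpace3.signature_ι₁ V, HodgeCM.HermSpace3.posDef_of_ne V⟩ : Summit.HodgeConjecture.CorCM.HermSpace3 ⟨HodgeCM.CMField.K F⟩ ι₁) Φ Φ' (frameD V) (ιVE V) (diagonal_frameD_map_complexConj F V)) (2 * imagUnit (HodgeCM.CMField.K F))⁻¹ (Summit.HodgeConjecture.CorCM.D2Bridge.MuConjIdent.repConj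 ⟨HodgeCM.CMField.K F⟩ (fun _ _ => (Rep.update ↥(maximalRealSubfield (HodgeCM.CMField.K F)) (imagUnitSq (HodgeCM.CMField.K F)) (Rep.ofLineOf ↥(maximalRealSubfield (HodgeCM.CMField.K F)) (imagUnitSq (HodgeCM.CMField.K F))) (locF ↥(maximalRealSubfield (HodgeCM.CMField.K F)) (imagUnitSq (HodgeCM.CMField.K F)) (realUnit ⟨HodgeCM.CMField.K F⟩ a.1 a.2.1 a.2.2)) (realUnit ⟨HodgeCM.CMField.K F⟩ a.1 a.2.1 a.2.2) rfl)))).rho ν hν)))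
    -- [Liu21, Def 4.11] ∕ [Prop 4.13] — VERBATIM ✔ p375902 (= ✔ p375090)
    (h411 : ∀ (F : HodgeCM.CMField) [IsGalois ℚ F] (h6 : 6 ≤ Module.finrank ℚ F) {ι₁ : F →+* ℂ} (V : HodgeCM.HermSpace3 F ι₁) (a : RealScalar F)
      (Φ : CMType F) (hΦ : ι₁ ∈ Φ.1) (μ : Literature.NumberTheory.Automorphic.IdeleClassGroup (F : Type) →ₜ* Circle)
      (hμ : IdeleClassGroup.IsConjugateSymplectic (F : Type) μ) (hw : IdeleClassGroup.HasWeight (F : Type) μ 1),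
      Def411AsPrinted (toThm418Data _ (restOfCharDeltaPrime (Summit.HodgeConjecture.CorCM.DelRec.exists_recordSystem_of_printed hDel) ⟨HodgeCM.CMField.K F⟩ h6 ι₁ ⟨HodgeCM.HermSpace3.Hm V, HodgeCM.HermSpace3.isHermitian V, HodgeCM.HermSpace3.signature_ι₁ V, HodgeCM.HermSpace3.posDef_of_ne V⟩ Φ e₁ (frameD V) (frameD_real V) (frameD_ne V) (ιVE V) (Rep.update ↥(maximalRealSubfield (HodgeCM.CMField.K F)) (imagUnitSq (HodgeCM.CMField.K F)) (Rep.ofLineOf ↥(maximalRealSubfield (HodgeCM.CMField.K F)) (imagUnitSq (HodgeCM.CMField.K F))) (locF ↥(maximalRealSubfield (HodgeCM.CMField.K F)) (imagUnitSq (HodgeCM.CMField.K F)) (realUnit ⟨HodgeCM.CMField.K F⟩ a.1 a.2.1 a.2.2)) (realUnit ⟨HodgeCM.CMField.K F⟩ a.1 a.2.1 a.2.2) rfl) μ hμ hw)))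
    (h413 : ∀ (F : HodgeCM.CMField) [IsGalois ℚ F] (h6 : 6 ≤ Module.finrank ℚ F) {ι₁ : F →+* ℂ} (V : HodgeCM.HermSpace3 F ι₁) (a₀ : RealScalar F)
      (Φ : CMType F) (hΦ : ι₁ ∈ Φ.1) (i : (I V (repAt a₀) (muLiu ι₁ GramClass.rep))), Prop413AsPrinted (((uniformOmegaRep (Summit.HodgeConjecture.CorCM.DelRec.exists_recordSystem_of_printed hDel) ⟨HodgeCM.CMField.K F⟩ ι₁ ⟨HodgeCM.HermSpace3.Hm V, HodgeCM.HermSpace3.isHermitian V, HodgeCM.HermSpace3.signature_ι₁ V, HodgeCM.HermSpace3.posDef_of_ne V⟩ Φ e₁ (frameD V) (frameD_real V) (frameD_ne V) (ιVE V) (2 * imagUnit (HodgeCM.CMField.K F))⁻¹ (fun _ _ => (Rep.update ↥(maximalRealSubfield (HodgeCM.CMField.K F)) (imagUnitSq (HodgeCM.CMField.K F)) (Rep.ofLineOf ↥(maximalRealSubfield (HodgeCM.CMField.K F)) (imagUnitSq (HodgeCM.CMField.K F))) (locF ↥(maximalRealSubfield (HodgeCM.CMField.K F)) (imagUnitSq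 (HodgeCM.CMField.K F)) (realUnit ⟨HodgeCM.CMField.K F⟩ (repAt a₀ (Sigma.fst i)).1 (repAt a₀ (Sigma.fst i)).2.1 (repAt a₀ (Sigma.fst i)).2.2)) (realUnit ⟨HodgeCM.CMField.K F⟩ (repAt a₀ (Sigma.fst i)).1 (repAt a₀ (Sigma.fst i)).2.1 (repAt a₀ (Sigma.fst i)).2.2) rfl)))).prop413Data ((liuDictionaryPin exists_isReal_hodgeModel_holds hodgePQ_independent_of_hodgeModel_holds BallQuotient.ballQuotientUniformised_holds (cmAbelianVarietyRealised_of_eigenbasis exists_isReal_hodgeModel_holds hodgePQ_independent_of_hodgeModel_holds cmAbelianVarietyEigenbasisRealised_holds) Literature.NumberTheory.Transcendental.arapura2012_cor_15_4_6_holds V (I V (repAt a₀) (muLiu ι₁ GramClass.rep)) (line V (repAt a₀) (muLiu ι₁ GramClass.rep)))).H))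
    -- [Liu21, App. D Lem D.1 (3)] AS PRINTED per place, read on the INDEXED FAMILY of the tree's own local data at U(J_V)(F⁺_v) of the admissible weight-one triples of 𝕌(a) — scalar-keyed
    (hD3 : ∀ (F : HodgeCM.CMField) [IsGalois ℚ F] (h6 : 6 ≤ Module.finrank ℚ F) {ι₁ : F →+* ℂ} (V : HodgeCM.HermSpace3 F ι₁) (a : RealScalar F)
      (Φ : CMType F) (hΦ : ι₁ ∈ Φ.1) (v : IsDedekindDomain.HeightOneSpectrum (𝓞 ↥(maximalRealSubfield (F : Type)))),
      LemD1_3AsPrintedI (Def411WeilCarriers.localIndexedFamilyAtV (ι := ((μw : {μ : Literature.NumberTheory.Automorphic.IdeleClassGroup (F : Type) →ₜ* Circle // IdeleClassGroup.IsConjugateSymplectic (F : Type) μ ∧ IdeleClassGroup.HasWeight (F : Type) μ 1}) × (toThm418Data _ (restOfCharDeltaPrime (Summit.HodgeConjecture.CorCM.DelRec.exists_recordSystem_of_printed hDel) ⟨HodgeCM.CMField.K F⟩ h6 ι₁ ⟨HodgeCM.HermSpace3.Hm V, HodgeCM.HermSpace3.isHermitian V, HodgeCM.HermSpace3.signature_ι₁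 V, HodgeCM.HermSpace3.posDef_of_ne V⟩ Φ e₁ (frameD V) (frameD_real V) (frameD_ne V) (ιVE V) (Rep.update ↥(maximalRealSubfield (HodgeCM.CMField.K F)) (imagUnitSq (HodgeCM.CMField.K F)) (Rep.ofLineOf ↥(maximalRealSubfield (HodgeCM.CMField.K F)) (imagUnitSq (HodgeCM.CMField.K F))) (locF ↥(maximalRealSubfield (HodgeCM.CMField.K F)) (imagUnitSq (HodgeCM.CMField.K F)) (realUnit ⟨HodgeCM.CMField.K F⟩ a.1 a.2.1 a.2.2)) (realUnit ⟨HodgeCM.CMField.K F⟩ a.1 a.2.1 a.2.2) rfl) μw.1 μw.2.1 μw.2.2)).AdmIndex)) ↥(maximalRealSubfield (F : Type)) (F : Type) (IsCMField.complexConj (F : Type)) 3 e₁ (Matrix.diagonal (frameD V)) (complexConj_imagUnit (F : Type)) (imagUnit_ne_zero (F : Type)) (imagUnit_mul_self (F : Type)) (realDiagonal_isSymm (F : Type) (frameD V) (frameD_real V)) (isUnit_det_realDiagonal (F : Type) (frameD V) (frameD_real V) (frameD_ne V)) (realDiagonal_map (F : Type) (frameD V) (frameD_real V)).symm (le_refl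 3) (fun t => (Rep.update ↥(maximalRealSubfield (HodgeCM.CMField.K F)) (imagUnitSq (HodgeCM.CMField.K F)) (Rep.ofLineOf ↥(maximalRealSubfield (HodgeCM.CMField.K F)) (imagUnitSq (HodgeCM.CMField.K F))) (locF ↥(maximalRealSubfield (HodgeCM.CMField.K F)) (imagUnitSq (HodgeCM.CMField.K F)) (realUnit ⟨HodgeCM.CMField.K F⟩ a.1 a.2.1 a.2.2)) (realUnit ⟨HodgeCM.CMField.K F⟩ a.1 a.2.1 a.2.2) rfl).toFun t.2.1.1) (fun t => t.2.1.2) (fun t => OmegaChiSplitting.chiLocalSplittingsD ⟨HodgeCM.CMField.K F⟩ e₁ (frameD V) (frameD_real V) (frameD_ne V) (toHeckeCharacter (F : Type) t.1.1) ((isOscillatorChar_toHeckeCharacter_iff t.1.1).mpr t.1.2.1) ((Rep.update ↥(maximalRealSubfield (HodgeCM.CMField.K F)) (imagUnitSq (HodgeCM.CMField.K F)) (Rep.ofLineOf ↥(maximalRealSubfield (HodgeCM.CMField.K F)) (imagUnitSq (HodgeCM.CMField.K F))) (locF ↥(maximalRealSubfield (HodgeCM.CMField.K F)) (imagUnitSq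 (HodgeCM.CMField.K F)) (realUnit ⟨HodgeCM.CMField.K F⟩ a.1 a.2.1 a.2.2)) (realUnit ⟨HodgeCM.CMField.K F⟩ a.1 a.2.1 a.2.2) rfl).toFun t.2.1.1)) (fun t => localMu (F : Type) (toHeckeCharacter (F : Type) t.1.1)) (fun t v x => norm_localMu (F : Type) (toHeckeCharacter (F : Type) t.1.1) v (isUnitary_toHeckeCharacter (F : Type) t.1.1) x) (fun t => continuous_localMu (F : Type) (toHeckeCharacter (F : Type) t.1.1)) (fun t v x => localMu_toLocalRing_eq_one_iff (F : Type) (toHeckeCharacter (F : Type) t.1.1) v ((isOscillatorChar_toHeckeCharacter_iff t.1.1).mpr t.1.2.1) x) v))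
    -- [Liu21, App. D Lem D.1 (1)] AS PRINTED per place at the local data of 𝔯δ′⟦a, μ⟧ — VERBATIM ✔ p375902, UNGUARDED
    (hD1'' : ∀ (F : HodgeCM.CMField) [IsGalois ℚ F] (h6 : 6 ≤ Module.finrank ℚ F) {ι₁ : F →+* ℂ} (V : HodgeCM.HermSpace3 F ι₁) (a : RealScalar F)
      (Φ : CMType F) (hΦ : ι₁ ∈ Φ.1) (μ : Literature.NumberTheory.Automorphic.IdeleClassGroup (F : Type) →ₜ* Circle)
      (hμ : IdeleClassGroup.IsConjugateSymplectic (F : Type) μ) (hw : IdeleClassGroup.HasWeight (F : Type) μ 1)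
      (j : (toThm418Data _ (restOfCharDeltaPrime (Summit.HodgeConjecture.CorCM.DelRec.exists_recordSystem_of_printed hDel) ⟨HodgeCM.CMField.K F⟩ h6 ι₁ ⟨HodgeCM.HermSpace3.Hm V, HodgeCM.HermSpace3.isHermitian V, HodgeCM.HermSpace3.signature_ι₁ V, HodgeCM.HermSpace3.posDef_of_ne V⟩ Φ e₁ (frameD V) (frameD_real V) (frameD_ne V) (ιVE V) (Rep.update ↥(maximalRealSubfield (HodgeCM.CMField.K F)) (imagUnitSq (HodgeCM.CMField.K F)) (Rep.ofLineOf ↥(maximalRealSubfield (HodgeCM.CMField.K F)) (imagUnitSq (HodgeCM.CMField.K F))) (locF ↥(maximalRealSubfield (HodgeCM.CMField.K F)) (imagUnitSq (HodgeCM.CMField.K F)) (realUnit ⟨HodgeCM.CMField.K F⟩ a.1 a.2.1 a.2.2)) (realUnit ⟨HodgeCM.CMField.K F⟩ a.1 a.2.1 a.2.2) rfl) μ hμ hw)).AdmIndex) (v : IsDedekindDomain.HeightOneSpectrum (𝓞 ↥(maximalRealSubfield (F : Type)))),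
      LemD1_1AsPrinted
        (Def411WeilCarriers.localLemD1Data ↥(maximalRealSubfield (F : Type)) (F : Type) (IsCMField.complexConj (F : Type)) 3 e₁
          (Matrix.diagonal (frameD V)) (complexConj_imagUnit (F : Type)) (imagUnit_ne_zero (F : Type)) (imagUnit_mul_self (F : Type))
          (realDiagonal_isSymm (F : Type) (frameD V) (frameD_real V)) (isUnit_det_realDiagonal (F : Type) (frameD V) (frameD_real V) (frameD_ne V))
          (realDiagonal_map (F : Type) (frameD V) (frameD_real V)).symm (((Rep.update ↥(maximalRealSubfield (HodgeCM.CMField.K F)) (imagUnitSq (HodgeCM.CMField.K F)) (Rep.ofLineOf ↥(maximalRealSubfield (HodgeCM.CMField.K F)) (imagUnitSq (HodgeCM.CMField.K F))) (locF ↥(maximalRealSubfield (HodgeCM.CMField.K F)) (imagUnitSq (HodgeCM.CMField.K F)) (realUnit ⟨HodgeCM.CMField.K F⟩ a.1 a.2.1 a.2.2)) (realUnit ⟨HodgeCM.CMField.K F⟩ a.1 a.2.1 a.2.2) rfl)).toFun j.1.1)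
          (OmegaChiSplitting.chiLocalSplittingsD ⟨HodgeCM.CMField.K F⟩ e₁ (frameD V) (frameD_real V) (frameD_ne V) (toHeckeCharacter (F : Type) μ)
            ((isOscillatorChar_toHeckeCharacter_iff μ).mpr hμ) (((Rep.update ↥(maximalRealSubfield (HodgeCM.CMField.K F)) (imagUnitSq (HodgeCM.CMField.K F)) (Rep.ofLineOf ↥(maximalRealSubfield (HodgeCM.CMField.K F)) (imagUnitSq (HodgeCM.CMField.K F))) (locF ↥(maximalRealSubfield (HodgeCM.CMField.K F)) (imagUnitSq (HodgeCM.CMField.K F)) (realUnit ⟨HodgeCM.CMField.K F⟩ a.1 a.2.1 a.2.2)) (realUnit ⟨HodgeCM.CMField.K F⟩ a.1 a.2.1 a.2.2) rfl)).toFun j.1.1))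
          (le_refl 3) (localMu (F : Type) (toHeckeCharacter (F : Type) μ))
          (fun v x => norm_localMu (F : Type) (toHeckeCharacter (F : Type) μ) v (isUnitary_toHeckeCharacter (F : Type) μ) x)
          (continuous_localMu (F : Type) (toHeckeCharacter (F : Type) μ))
          (fun v t => localMu_toLocalRing_eq_one_iff (F : Type) (toHeckeCharacter (F : Type) μ) v ((isOscillatorChar_toHeckeCharacter_iff μ).mpr hμ) t)
          j.1.2.1
          (Def411WeilCarriers.norm_chi_eq_one ↥(maximalRealSubfield (F : Type)) (F : Type) (IsCMField.complexConj (F : Type))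
            (Algebra.IsQuadraticExtension.finrank_eq_two ↥(maximalRealSubfield (F : Type)) (F : Type))
            (UnitaryGroup.algEquiv_ne_one_of_apply_eq_neg ↥(maximalRealSubfield (F : Type)) (F : Type) (IsCMField.complexConj (F : Type))
              (complexConj_imagUnit (F : Type)) (imagUnit_ne_zero (F : Type))) j.1.2)
          j.1.2.2.1 v))
    : HC_CM :=
  Summit.HodgeConjecture.CorCM.D2Bridge.MuKeyIdentLemD3End.hc_cm_of_printed_citations_muKey_ident_lemD3
    (Summit.HodgeConjecture.CorCM.DelRec.exists_recordSystem_of_printed hDel) h21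
    (fun F hG h6 {ι₁} V a Φ hΦ ν hν hw => by
      haveI : IsGalois ℚ F := hG
      -- the identification binder DISCHARGED IN KERNEL: RSCONJ row R6 over `Model.RecordSystemConj.exists_conj` (module `HComp.RecordSystemConj`)
      obtain ⟨R', hR'⟩ :=
        Summit.HodgeConjecture.CorCM.D2Bridge.MuConjIdent.exists_recordSystemConj_X_sec42DataOf_levelOf_eq
          (Summit.HodgeConjecture.CorCM.DelRec.exists_recordSystem_of_printed hDel)
          (⟨HodgeCM.HermSpace3.Hm V, HodgeCM.HermSpace3.isHermitian V, HodgeCM.HermSpace3.signature_ι₁ V, HodgeCM.HermSpace3.posDef_of_ne V⟩ : Summit.HodgeConjecture.CorCM.HermSpace3 ⟨HodgeCM.CMField.K F⟩ ι₁) Φ isoOf h6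
      -- T CONSUMED IN KERNEL: [Thm. 4.18] at the conjugate space's transported datum is TRANSPORTED BACK to the printed datum `D_print(a, ν)` by ✔ Ω-VII
      -- `MuConjIdent.thm418AsPrinted_muConj_rest_of_transport_hermConj` (which consumes ✔ Ω-M internally); `Φ′ := Φ`; the tail `t` is read off the
      -- displayed row; `c(δ′) = −δ′`, `δ′ ≠ 0` for `δ′ = (2δ_F)⁻¹` are ✔ `OmegaTransport.complexConj_inv_two_mul_imagUnit ∕ inv_two_mul_imagUnit_ne_zero`;
      -- the slot elaborates because `(muConj 𝕌).rest t` IS `D_print(a, ν)` definitionally (✔ `MuConjIdent.toThm418Data_muConj_rest_eq_printed_ofRecord`, `rfl`) — T-4.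
      exact Summit.HodgeConjecture.CorCM.D2Bridge.MuConjIdent.thm418AsPrinted_muConj_rest_of_transport_hermConj ⟨HodgeCM.CMField.K F⟩ (Summit.HodgeConjecture.CorCM.DelRec.exists_recordSystem_of_printed hDel) ι₁
        (⟨HodgeCM.HermSpace3.Hm V, HodgeCM.HermSpace3.isHermitian V, HodgeCM.HermSpace3.signature_ι₁ V, HodgeCM.HermSpace3.posDef_of_ne V⟩ : Summit.HodgeConjecture.CorCM.HermSpace3 ⟨HodgeCM.CMField.K F⟩ ι₁) Φ Φ e₁ (frameD V) (ιVE V) (2 * imagUnit (HodgeCM.CMField.K F))⁻¹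
        (fun _ _ => (Rep.update ↥(maximalRealSubfield (HodgeCM.CMField.K F)) (imagUnitSq (HodgeCM.CMField.K F)) (Rep.ofLineOf ↥(maximalRealSubfield (HodgeCM.CMField.K F)) (imagUnitSq (HodgeCM.CMField.K F))) (locF ↥(maximalRealSubfield (HodgeCM.CMField.K F)) (imagUnitSq (HodgeCM.CMField.K F)) (realUnit ⟨HodgeCM.CMField.K F⟩ a.1 a.2.1 a.2.2)) (realUnit ⟨HodgeCM.CMField.K F⟩ a.1 a.2.1 a.2.2) rfl))
        (frameD_real V) (frameD_ne V) (diagonal_frameD_map_complexConj F V)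
        (Summit.HodgeConjecture.CorCM.Transposition.OmegaTransport.complexConj_inv_two_mul_imagUnit ⟨HodgeCM.CMField.K F⟩)
        (Summit.HodgeConjecture.CorCM.Transposition.OmegaTransport.inv_two_mul_imagUnit_ne_zero ⟨HodgeCM.CMField.K F⟩) ν hν _
        (hLiu418 F h6 V a Φ hΦ ν hν hw R' hR' Φ))
    h411 h413 hD3 hD1''

end Summit.HodgeConjecture.CorCM.D2Bridge.MuKeyIdentLemD3DelRecConjOmegaEndT

end
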